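import Mathlib
import Summits.QuantumFields.BalabanUV.Beta.CovariantPlateauBlocksPair
import Literature.MathematicalPhysics.QuantumFieldTheory.Balaban1983to89.B9Eq335Plaquette

/-!
# Beta / CovariantPlateauBlocksPairCurl — THE TWO-TRANSPORT E-I3 MODEL END FROM A (3.35)-SHAPE HYPOTHESIS WITH BOTH HALVES:
# in a per-block orthogonal gauge the in-block bond transporters are `a`-close to `1` (the `|A|`-half) AND parallel bond
# transporters across an in-block plaquette differ by at most `f` (the `|∇^ηA|`-half, covariant reading); then every in-block
# plaquette is within `α = 2f + 2a²` of `1` (b09-g7's plaquette algebra `B9Eq335Plaquette` §1 BY NAME + gauge covariance of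
# the plaquette), so beta-d4-p2's two-transport END `CovariantPlateauBlocksPair.coarse_coercive_plateau_blocks_pair` (p223754,
# over this unit's `CoarseCoerciveTransportPair.coarse_coercive_cov₂` p222847) applies with that `α`; and the j-UNIFORMITY
# ARITHMETIC: `a ≤ C∕n`, `f ≤ C∕n²` ⟹ `n²α ≤ 2C(1+C)`, mixed-loop defect `ε ≤ ν²C(1+C)`, thin-loop bound `H·n ≤ 2νC(1+C)`
# (unit `b2b-balaban-beta-d4-p3`, GEN 7, row-D4 co-owner #3, road P3 «reduction road»; claim «E-I3-COV-PAIR-CURL» journal l.16539)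

HONEST FRAMING (cell rule).  Discharging `BetaPertH` makes Bałaban's UV stability UNCONDITIONAL — a real constructive-QFT
result; NOT the continuum limit, NOT the Clay problem.  HONEST DEPENDENCY (verbatim): «continuum YM on T⁴ ⇐ BetaPertH ∧ nine
spine estimates (0/9 proved); BetaPertH ⇐ (D1) ∧ (D4) ∧ CAP+tail; G-an2-4 gates asym, D1 and NE2/3/4.»  THIS MODULE DISCHARGES
NOTHING of `BetaPertH`, asserts NOTHING printed and cites nothing as a fact (ABSOLUTE RULE): [folklore] normed-ring algebra and
real arithmetic about beta-d4-p2's MODEL (cubic blocks of side `n`, any gluing `σ`, orthogonal bond transporters `W` and block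
gauges `g` as DATA, one fine field along fine monotone contours — Bałaban's AVERAGED legs `Ū^l` of (3.55) are NOT modelled, his
operators are NOT instantiated).  The hypothesis SHAPE is located at [B9] = `Balaban1985BackgroundPropagators`, p. 396 (3.35),
READ AS IMAGE 2026-08-20 by this seat (`HOME/b2b-balaban-ref1/pages/1985-cmp99-background-propagators/…-p008-x2.png`), verbatim:
«for an arbitrary cube □ of the described above class, and for a configuration U there exists a gauge transformation u on □
such that U^u = e^{iηA}, and if the index of □ is j, then |A| < O(1)Mα₀(L^jη)^{−1}, |∇^ηA| < O(1)Mα₀(L^jη)^{−2} on □, where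
O(1)M is a size of □ in T_{L^{−j}}; (3.35)».  In the MODEL the two displayed bounds become: gauged bond transporters
`u_b = g(v)·W_b·g(v′)ᵀ` with `‖u_b − 1‖ ≤ a` (`a ≍ η·O(1)Mα₀(L^jη)^{−1} = C∕n`, `n = L^j`, `C = O(1)Mα₀`) and, for the two bonds
of an in-block plaquette parallel to `e_κ`, `‖u_{b+e_μ} − u_b‖ ≤ f` (`f ≍ η²·O(1)Mα₀(L^jη)^{−2} = C∕n²` — the COVARIANT reading
of `|∇^ηA|`; b09-g7's header records that the covariant and the ordinary readings differ by a term of the same order).  (3.35)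
is a HYPOTHESIS of B9's Theorem 3.1 (the regularity class), so after this module the MODEL chain's field input is a QUOTATION
of a printed hypothesis shape, not a derived quantity; that Bałaban's backgrounds `U_k` lie in the class is the T⁴ spine's
business (B8∕B10), not row D4's.  No class change on row D4 or G-B9-15 (width 0; D4 DISCHARGE NO DATE); NOT BetaPertH, NOT
continuum, NOT Clay, NOT summit progress.

WHY (located).  The row-D4 owner's NOTE-I3 v1.2.2 §6.6 (last sentence): «The thin-loop bound h_thin = O(Mα₀∕n) genuinely
needs the FIELD-STRENGTH half + the thin area count: the |A|-half only gives O(Mα₀) per loop.»  beta-d4-p2's part 6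
`CovariantPlateauBlocksPairGauge` (p224168) wires the two-transport END from the |A|-half ALONE with `H = (2ν(n−1)+1)·ε_g`
— true, but `H ≍ n·ε_g = O(Mα₀)` is not thin, so its energy constant `(1∕w + H)²` is not within `(1 + O(Mα₀))²` of the
`U = 1` slope `(1∕w)²`, `w ≍ n∕4` (harmless if a fine-scale mass `μ₀ ≳ 1` dominates `E`; decisive for block-scale masses
`μ₀ ≲ w⁻²`, where `(1 + Hw)² ≍ (Mα₀·n)²`).  Part 4 `CovariantPlateauBlocksPair` (p223754) takes instead ONE per-plaquette input
`‖plaqW − 1‖ ≤ α` and gives `ε = (ν(n−1) choose 2)·α`, `H = ν(n−1)·α` — both j-uniform when `n²α = O(Mα₀)`.  This module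
supplies that `α` from the (3.35) SHAPE: `α = 2f + 2a²`, `n²α ≤ 2C(1+C)`.  The abstract plaquette step is b09-g7's
(`B9Eq335Plaquette`, GAPS C-B9-42: `‖u₁u₂u₃′u₄′ − 1‖ ≤ ‖u₁ − u₃‖ + ‖u₂ − u₄‖ + 2‖u₃ − 1‖‖u₄ − 1‖` for norm-≤-1 factors, and
the gauge invariance `‖w x w′ − 1‖ = ‖x − 1‖`), consumed BY NAME; the MODEL glue (fourth-corner bookkeeping of `succOff`, the
orthogonality of gauged bonds, the complexified norms) is this file's.

CONTENT (kernel, 0 sorry).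
§1 `succOff` bookkeeping: `succOff_apply_self∕_ne`, the fourth corner `succOff (succOff v κ) μ = succOff (succOff v μ) κ`.
§2 the gauged bond `gbond g y v κ h = g(v)·W((y,v),κ)·g(v+e_κ)ᵀ` (the expression of p224168's `h335`, named), its
   orthogonality, and **`conj_plaqW_eq`**: `g(v)·plaqW·g(v)ᵀ = u₁·u₂·u₃ᵀ·u₄ᵀ`.
§3 **`norm_cpx_plaqW_sub_one_eq`** (gauge invariance of the plaquette defect) and **`hplaqW_of_gauge335`**:
   (h335A) + (h335F) ⟹ `‖cpx(plaqW) − 1‖ ≤ 2f + 2a²` on every in-block plaquette — EXACTLY the `hplaqW` of p223754.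
§4 ENDs **`coarse_coercive_plateau_blocks_pair_curl`** (every monotone contour family `ω`) and
   **`coarse_coercive_plateau_blocks_nested_curl`** (the (3.55)-shape chains) = p223754 BY NAME with `α := 2f + 2a²`.
§5 the j-uniformity arithmetic: `choose_two_le`, **`nsq_alpha_le`** (`n²(2f + 2a²) ≤ 2C(1+C)`), **`eps_mixed_le`**
   (`(ν(n−1) choose 2)·α ≤ ν²C(1+C)`), **`thin_times_n_le`** (`ν(n−1)α·n ≤ 2νC(1+C)`).
§6 non-vacuity (flat `W`, trivial gauge: `a = f = 0`, constant `1∕54` on `nestedList 2 1`).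
PRIOR ART (`lean search 'plaq_sub_one|b7_52_of_b9_335|hplaqW'`, 2026-08-20): b09-g7's abstract forms; beta-d4-p2 parts 1–6
(`hplaqW` a hypothesis; gauge form for BONDS only).  No (3.35)-both-halves ⟹ `hplaqW` glue in the tree.
-/

namespace Summit.QuantumFields.BalabanUV.Beta.CovariantPlateauBlocksPairCurl

open scoped BigOperators Matrix Matrix.Norms.L2Operator
open Finset
open Literature.MathematicalPhysics.QuantumFieldTheory.Balaban1983to89.B5Prop11Lower (nsq nsq_nonneg)
open Literature.MathematicalPhysics.QuantumFieldTheory.Balaban1983to89.B7Prop1Explicit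
open Literature.MathematicalPhysics.QuantumFieldTheory.Balaban1983to89 (B9Eq335Plaquette.norm_plaq_sub_one_le_of_norm_le_one
  B9Eq335Plaquette.norm_conj_sub_one_eq)
open Summit.QuantumFields.BalabanUV.Beta.AccretiveCombesThomasSandwich (sandwich)
open Summit.QuantumFields.BalabanUV.Beta.CoarseCoerciveTransport (covFamily)
open Summit.QuantumFields.BalabanUV.Beta.CoarseCoerciveCovariantEnergy (covDiff)
open Summit.QuantumFields.BalabanUV.Beta.CoarseCoerciveBlock1D (gramForm)
open Summit.QuantumFields.BalabanUV.Beta.ThinLoopHolonomy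
open Summit.QuantumFields.BalabanUV.Beta.MonotoneLoopHolonomy
open Summit.QuantumFields.BalabanUV.Beta.CovariantPlateauBlocks
open Summit.QuantumFields.BalabanUV.Beta.CovariantPlateauBlocksEnd
open Summit.QuantumFields.BalabanUV.Beta.CovariantPlateauBlocksPair

noncomputable section

/-! ## §1 `succOff` bookkeeping: the fourth corner of a plaquette -/

section Succ

variable {ν n : ℕ}

/-- `(v + e_i)_i = v_i + 1`. [folklore] -/
theorem succOff_apply_self (v : Off ν n) (i : Fin ν) (h : (v i : ℕ) + 1 < n) :
    ((succOff v i h) i : ℕ) = v i + 1 := by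
  simp [succOff]

/-- `(v + e_i)_j = v_j` for `j ≠ i`. [folklore] -/
theorem succOff_apply_ne (v : Off ν n) (i : Fin ν) (h : (v i : ℕ) + 1 < n) {j : Fin ν} (hj : j ≠ i) :
    (succOff v i h) j = v j := by
  simp [succOff, Function.update_of_ne hj]

/-- Across a plaquette in the directions `κ ≠ μ`: the bond parallel to `e_μ` at `v + e_κ` stays in the block iff the one at
`v` does. [folklore] -/
theorem succ_lt_of_ne (v : Off ν n) {κ μ : Fin ν} (hκμ : κ ≠ μ) (hκ : (v κ : ℕ) + 1 < n) (hμ : (v μ : ℕ) + 1 < n) :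
    ((succOff v κ hκ) μ : ℕ) + 1 < n := by
  rw [succOff_apply_ne v κ hκ hκμ.symm]; exact hμ

/-- **THE FOURTH CORNER**: `(v + e_κ) + e_μ = (v + e_μ) + e_κ` as in-block offsets (any admissible bound proofs). [folklore] -/
theorem succOff_succOff_comm (v : Off ν n) {κ μ : Fin ν} (hκμ : κ ≠ μ) (hκ : (v κ : ℕ) + 1 < n)
    (hμ : (v μ : ℕ) + 1 < n) (h₂ : ((succOff v κ hκ) μ : ℕ) + 1 < n) (h₃ : ((succOff v μ hμ) κ : ℕ) + 1 < n) :
    succOff (succOff v κ hκ) μ h₂ = succOff (succOff v μ hμ) κ h₃ := by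
  funext i
  apply Fin.ext
  by_cases hiκ : i = κ
  · subst hiκ
    rw [succOff_apply_ne _ μ h₂ hκμ, succOff_apply_self, succOff_apply_self, succOff_apply_ne _ μ hμ hκμ]
  · by_cases hiμ : i = μ
    · subst hiμ
      rw [succOff_apply_self, succOff_apply_ne _ κ h₃ hiκ, succOff_apply_self, succOff_apply_ne _ κ hκ hiκ]
    · rw [succOff_apply_ne _ μ h₂ hiμ, succOff_apply_ne _ κ hκ hiκ, succOff_apply_ne _ κ h₃ hiκ,
        succOff_apply_ne _ μ hμ hiμ]

end Succ

/-! ## §2 Gauged bonds and the gauge covariance of the in-block plaquette -/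

section Gauge

variable {Y : Type*} {Cp : Type*} [Fintype Cp] [DecidableEq Cp] {ν n : ℕ}
variable (W : Bond Y ν n → Matrix Cp Cp ℝ) (hW : ∀ b, (W b)ᵀ * W b = 1)
variable (g : Y → Off ν n → Matrix Cp Cp ℝ) (hg : ∀ y v, (g y v)ᵀ * g y v = 1)

/-- **THE GAUGED BOND TRANSPORTER** `u_b = g(v)·W((y,v),κ)·g(v + e_κ)ᵀ` of an in-block bond in the block gauge `g` — the
expression bounded in beta-d4-p2's (3.35)-literal hypothesis `h335` (p223158∕p224168), named. [folklore] -/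
def gbond (y : Y) (v : Off ν n) (κ : Fin ν) (h : (v κ : ℕ) + 1 < n) : Matrix Cp Cp ℝ :=
  g y v * W ((y, v), κ) * (g y (succOff v κ h))ᵀ

omit [DecidableEq Cp] in
/-- `gbond` unfolds to p224168's expression (so its `h335` is this file's `h335A` verbatim). [folklore] -/
theorem gbond_eq (y : Y) (v : Off ν n) (κ : Fin ν) (h : (v κ : ℕ) + 1 < n) :
    gbond W g y v κ h = g y v * W ((y, v), κ) * (g y (succOff v κ h))ᵀ := rfl

include hg in
/-- `g·gᵀ = 1` as well (square matrices). [folklore] -/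
theorem g_mul_transpose (y : Y) (v : Off ν n) : g y v * (g y v)ᵀ = 1 := mul_eq_one_comm.mp (hg y v)

include hW hg in
/-- Gauged bonds are orthogonal: `u_bᵀ·u_b = 1`. [folklore] -/
theorem gbond_transpose_mul (y : Y) (v : Off ν n) (κ : Fin ν) (h : (v κ : ℕ) + 1 < n) :
    (gbond W g y v κ h)ᵀ * gbond W g y v κ h = 1 := by
  unfold gbond
  rw [Matrix.transpose_mul, Matrix.transpose_mul, Matrix.transpose_transpose]
  calc g y (succOff v κ h) * ((W ((y, v), κ))ᵀ * (g y v)ᵀ) * (g y v * W ((y, v), κ) * (g y (succOff v κ h))ᵀ)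
      = g y (succOff v κ h) * ((W ((y, v), κ))ᵀ * ((g y v)ᵀ * g y v) * W ((y, v), κ)) * (g y (succOff v κ h))ᵀ := by
        simp only [Matrix.mul_assoc]
    _ = 1 := by rw [hg, Matrix.mul_one, hW, Matrix.mul_one, g_mul_transpose g hg]

include hW hg in
/-- … and `u_b·u_bᵀ = 1`. [folklore] -/
theorem gbond_mul_transpose (y : Y) (v : Off ν n) (κ : Fin ν) (h : (v κ : ℕ) + 1 < n) :
    gbond W g y v κ h * (gbond W g y v κ h)ᵀ = 1 :=
  mul_eq_one_comm.mp (gbond_transpose_mul W hW g hg y v κ h)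

include hg in
/-- **GAUGE COVARIANCE OF THE PLAQUETTE**: for `κ ≠ μ` and an in-block plaquette at `v`,
`g(v)·plaqW·g(v)ᵀ = u₁·u₂·u₃ᵀ·u₄ᵀ` with the gauged bonds `u₁ = u_{(v,κ)}`, `u₂ = u_{(v+e_κ,μ)}`, `u₃ = u_{(v+e_μ,κ)}`,
`u₄ = u_{(v,μ)}` — the intermediate gauge factors cancel (`gᵀg = 1`) and the two fourth-corner factors agree
(`succOff_succOff_comm`). [cite: Balaban1985Averaging, (44) p.24] -/
theorem conj_plaqW_eq (y : Y) (v : Off ν n) {κ μ : Fin ν} (hκμ : κ ≠ μ) (hκ : (v κ : ℕ) + 1 < n)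
    (hμ : (v μ : ℕ) + 1 < n) :
    g y v * plaqW W y v κ μ hκ hμ * (g y v)ᵀ =
      gbond W g y v κ hκ * gbond W g y (succOff v κ hκ) μ (succ_lt_of_ne v hκμ hκ hμ) *
        (gbond W g y (succOff v μ hμ) κ (succ_lt_of_ne v hκμ.symm hμ hκ))ᵀ * (gbond W g y v μ hμ)ᵀ := by
  have h4 : succOff (succOff v κ hκ) μ (succ_lt_of_ne v hκμ hκ hμ) =
      succOff (succOff v μ hμ) κ (succ_lt_of_ne v hκμ.symm hμ hκ) := succOff_succOff_comm v hκμ hκ hμ _ _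
  unfold gbond plaqW
  rw [h4, Matrix.transpose_mul, Matrix.transpose_mul, Matrix.transpose_transpose, Matrix.transpose_mul,
    Matrix.transpose_mul, Matrix.transpose_transpose]
  set c := succOff (succOff v μ hμ) κ (succ_lt_of_ne v hκμ.symm hμ hκ) with hc
  set G0 := g y v
  set Gκ := g y (succOff v κ hκ)
  set Gμ := g y (succOff v μ hμ)
  set Gc := g y c
  set W1 := W ((y, v), κ)
  set W2 := W ((y, succOff v κ hκ), μ)
  set W3 := W ((y, succOff v μ hμ), κ)
  set W4 := W ((y, v), μ)
  have hκ' : Gκᵀ * Gκ = 1 := hg y _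
  have hμ' : Gμᵀ * Gμ = 1 := hg y _
  have hc' : Gcᵀ * Gc = 1 := hg y _
  symm
  calc G0 * W1 * Gκᵀ * (Gκ * W2 * Gcᵀ) * (Gc * (W3ᵀ * Gμᵀ)) * (Gμ * (W4ᵀ * G0ᵀ))
      = G0 * W1 * (Gκᵀ * Gκ) * W2 * (Gcᵀ * Gc) * W3ᵀ * (Gμᵀ * Gμ) * W4ᵀ * G0ᵀ := by
        simp only [Matrix.mul_assoc]
    _ = G0 * (W1 * W2 * W3ᵀ * W4ᵀ) * G0ᵀ := by
        rw [hκ', hμ', hc', Matrix.mul_one, Matrix.mul_one, Matrix.mul_one]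
        simp only [Matrix.mul_assoc]

end Gauge

/-! ## §3 Gauge invariance of the plaquette defect; `hplaqW` from the (3.35) shape -/

section Defect

variable {Y : Type*} {Cp : Type*} [Fintype Cp] [DecidableEq Cp] {ν n : ℕ}
variable (W : Bond Y ν n → Matrix Cp Cp ℝ) (hW : ∀ b, (W b)ᵀ * W b = 1)
variable (g : Y → Off ν n → Matrix Cp Cp ℝ) (hg : ∀ y v, (g y v)ᵀ * g y v = 1)

include hg in
/-- **THE PLAQUETTE DEFECT IS GAUGE INVARIANT**: `‖cpx(g(v)·P·g(v)ᵀ) − 1‖ = ‖cpx(P) − 1‖` for orthogonal `g(v)` (b09-g7's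
`norm_conj_sub_one_eq` with the complexified gauge factors, which have norm `≤ 1`). [cite: Balaban1985BackgroundPropagators, (3.33)–(3.35) p.396] -/
theorem norm_cpx_conj_sub_one_eq (y : Y) (v : Off ν n) (P : Matrix Cp Cp ℝ) :
    ‖cpxHom (g y v * P * (g y v)ᵀ) - 1‖ = ‖cpxHom P - 1‖ := by
  rw [map_mul, map_mul]
  have hgt : ((g y v)ᵀ)ᵀ * (g y v)ᵀ = 1 := by rw [Matrix.transpose_transpose]; exact mul_eq_one_comm.mp (hg y v)
  refine B9Eq335Plaquette.norm_conj_sub_one_eq (cpxHom (g y v)) (cpxHom P) (cpxHom (g y v)ᵀ) ?_ ?_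
    (norm_cpxHom_le_one _ (hg y v)) (norm_cpxHom_le_one _ hgt)
  · rw [← map_mul, mul_eq_one_comm.mp (hg y v), map_one]
  · rw [← map_mul, hg y v, map_one]

include hW hg in
/-- **(3.35), BOTH HALVES ⟹ THE PER-PLAQUETTE INPUT OF p223754.**  In a per-block orthogonal gauge `g`: (h335A) every in-block
gauged bond is `a`-close to `1` (the `|A|`-half — p224168's `h335` verbatim) and (h335F) the two gauged bonds parallel to `e_κ`
across an in-block plaquette differ by at most `f` (the `|∇^ηA|`-half, covariant reading); then
`‖cpx(plaqW) − 1‖ ≤ 2f + 2a²` on every in-block plaquette. [cite: Balaban1985BackgroundPropagators, (3.35) p.396] -/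
theorem hplaqW_of_gauge335 {a f : ℝ}
    (h335A : ∀ (y : Y) (v : Off ν n) (κ : Fin ν) (h : (v κ : ℕ) + 1 < n),
      ‖cpxHom (g y v * W ((y, v), κ) * (g y (succOff v κ h))ᵀ) - 1‖ ≤ a)
    (h335F : ∀ (y : Y) (v : Off ν n) (κ μ : Fin ν) (hκ : (v κ : ℕ) + 1 < n) (hμ : (v μ : ℕ) + 1 < n)
      (hκ' : ((succOff v μ hμ) κ : ℕ) + 1 < n),
      ‖cpxHom (g y (succOff v μ hμ) * W ((y, succOff v μ hμ), κ) * (g y (succOff (succOff v μ hμ) κ hκ'))ᵀ) -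
        cpxHom (g y v * W ((y, v), κ) * (g y (succOff v κ hκ))ᵀ)‖ ≤ f)
    (y : Y) (v : Off ν n) (κ μ : Fin ν) (hκ : (v κ : ℕ) + 1 < n) (hμ : (v μ : ℕ) + 1 < n) (hκμ : κ ≠ μ) :
    ‖cpxHom (plaqW W y v κ μ hκ hμ) - 1‖ ≤ 2 * f + 2 * a ^ 2 := by
  set u₁ := gbond W g y v κ hκ
  set u₂ := gbond W g y (succOff v κ hκ) μ (succ_lt_of_ne v hκμ hκ hμ)
  set u₃ := gbond W g y (succOff v μ hμ) κ (succ_lt_of_ne v hκμ.symm hμ hκ)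
  set u₄ := gbond W g y v μ hμ
  have ha : 0 ≤ a := (norm_nonneg _).trans (h335A y v κ hκ)
  rw [← norm_cpx_conj_sub_one_eq g hg y v (plaqW W y v κ μ hκ hμ), conj_plaqW_eq W g hg y v hκμ hκ hμ, map_mul, map_mul,
    map_mul]
  have key := B9Eq335Plaquette.norm_plaq_sub_one_le_of_norm_le_one (cpxHom u₁) (cpxHom u₂) (cpxHom u₃) (cpxHom u₄)
    (cpxHom u₃ᵀ) (cpxHom u₄ᵀ)
    (by rw [← map_mul, gbond_mul_transpose W hW g hg, map_one]) (by rw [← map_mul, gbond_mul_transpose W hW g hg, map_one])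
    (norm_cpxHom_le_one _ (gbond_transpose_mul W hW g hg _ _ _ _))
    (norm_cpxHom_le_one _ (gbond_transpose_mul W hW g hg _ _ _ _))
    (norm_cpxHom_le_one _ (by rw [Matrix.transpose_transpose]; exact gbond_mul_transpose W hW g hg _ _ _ _))
    (norm_cpxHom_le_one _ (by rw [Matrix.transpose_transpose]; exact gbond_mul_transpose W hW g hg _ _ _ _))
  refine key.trans ?_
  have d13 : ‖cpxHom u₁ - cpxHom u₃‖ ≤ f := by
    rw [norm_sub_rev]; exact h335F y v κ μ hκ hμ (succ_lt_of_ne v hκμ.symm hμ hκ)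
  have d24 : ‖cpxHom u₂ - cpxHom u₄‖ ≤ f := h335F y v μ κ hμ hκ (succ_lt_of_ne v hκμ hκ hμ)
  have e3 : ‖cpxHom u₃ - 1‖ ≤ a := h335A y _ κ _
  have e4 : ‖cpxHom u₄ - 1‖ ≤ a := h335A y v μ hμ
  have e34 : 2 * ‖cpxHom u₃ - 1‖ * ‖cpxHom u₄ - 1‖ ≤ 2 * a * a := by
    gcongr
  nlinarith [norm_nonneg (cpxHom u₃ - 1), norm_nonneg (cpxHom u₄ - 1)]

end Defect

/-! ## §4 The two-transport ENDs from the (3.35) shape -/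

section End

variable {Y : Type*} [Fintype Y] [DecidableEq Y] {Cp : Type*} [Fintype Cp] [DecidableEq Cp] {ν n w : ℕ} [NeZero n]
variable (W : Bond Y ν n → Matrix Cp Cp ℝ) (hW : ∀ b, (W b)ᵀ * W b = 1) (ω : Off ν n → List (Fin ν))

/-- **E-I3 WITH TWO TRANSPORTS, MODEL INSTANCE, FROM THE (3.35) SHAPE (both halves).**  Blocks of side `n`, any gluing, any
fibre, orthogonal `W`, ANY monotone contour family `ω` for the average (bumps on the tree transports); a per-block orthogonal
gauge with bond closeness `a` and parallel-bond differences `f`; `α := 2f + 2a²`, `ε := (ν(n−1) choose 2)·α < 1`, `H := ν(n−1)·α`: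
`((1 − ε)((n−2w)∕n)^ν)² ∕ (μ₀·n^ν + (1∕w + H)(νn^ν(1∕w + H)))·‖B‖² ≤ Re B*(Q̃_ω A_W⁻¹ Q̃_ωᵀ)B` — beta-d4-p2's
`coarse_coercive_plateau_blocks_pair` (p223754) BY NAME with `hplaqW := hplaqW_of_gauge335`.
[cite: Balaban1985BackgroundPropagators, (3.35) p.396, (3.19) p.393, (3.55) p.401] -/
theorem coarse_coercive_plateau_blocks_pair_curl [Nonempty Cp] (σ : Fin ν → Y → Y)
    (g : Y → Off ν n → Matrix Cp Cp ℝ) (hg : ∀ y v, (g y v)ᵀ * g y v = 1) (hω : ∀ v, disp (posWord (ω v)) = emb v)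
    (hw : 0 < w) (h2w : 2 * w < n) {μ0 : ℝ} (hμ0 : 0 < μ0) {a f : ℝ} (hf : 0 ≤ f)
    (hε : ((ν * (n - 1)).choose 2 : ℕ) * (2 * f + 2 * a ^ 2) < 1)
    (h335A : ∀ (y : Y) (v : Off ν n) (κ : Fin ν) (h : (v κ : ℕ) + 1 < n),
      ‖cpxHom (g y v * W ((y, v), κ) * (g y (succOff v κ h))ᵀ) - 1‖ ≤ a)
    (h335F : ∀ (y : Y) (v : Off ν n) (κ μ : Fin ν) (hκ : (v κ : ℕ) + 1 < n) (hμ : (v μ : ℕ) + 1 < n)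
      (hκ' : ((succOff v μ hμ) κ : ℕ) + 1 < n),
      ‖cpxHom (g y (succOff v μ hμ) * W ((y, succOff v μ hμ), κ) * (g y (succOff (succOff v μ hμ) κ hκ'))ᵀ) -
        cpxHom (g y v * W ((y, v), κ) * (g y (succOff v κ hκ))ᵀ)‖ ≤ f)
    (B : Y × Cp → ℂ) :
    ((1 - ((ν * (n - 1)).choose 2 : ℕ) * (2 * f + 2 * a ^ 2)) * (((n : ℝ) - 2 * w) / n) ^ ν) ^ 2 /
        (μ0 * (1 * (n : ℝ) ^ ν) + (1 / w + ν * ((n : ℝ) - 1) * (2 * f + 2 * a ^ 2)) *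
          (ν * (n : ℝ) ^ ν * (1 / w + ν * ((n : ℝ) - 1) * (2 * f + 2 * a ^ 2)))) * nsq B ≤
      (star B ⬝ᵥ (sandwich (gramForm μ0 (covDiff bsrc (btgt σ) W)) (covFamily sB (RgenFam W hW ω)) *ᵥ B)).re :=
  coarse_coercive_plateau_blocks_pair W hW ω σ hω hw h2w hμ0 (by positivity) hε
    (fun y v κ μ hκ hμ hκμ => hplaqW_of_gauge335 W hW g hg h335A h335F y v κ μ hκ hμ hκμ) B

/-- **… FOR THE RECURSIVE CHAINS OF (3.55)** (nested block base points, any `L`, any depth `m`).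
[cite: Balaban1985BackgroundPropagators, (3.35) p.396, (3.55) p.401] -/
theorem coarse_coercive_plateau_blocks_nested_curl [Nonempty Cp] (σ : Fin ν → Y → Y) (L m : ℕ)
    (g : Y → Off ν n → Matrix Cp Cp ℝ) (hg : ∀ y v, (g y v)ᵀ * g y v = 1)
    (hw : 0 < w) (h2w : 2 * w < n) {μ0 : ℝ} (hμ0 : 0 < μ0) {a f : ℝ} (hf : 0 ≤ f)
    (hε : ((ν * (n - 1)).choose 2 : ℕ) * (2 * f + 2 * a ^ 2) < 1)
    (h335A : ∀ (y : Y) (v : Off ν n) (κ : Fin ν) (h : (v κ : ℕ) + 1 < n),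
      ‖cpxHom (g y v * W ((y, v), κ) * (g y (succOff v κ h))ᵀ) - 1‖ ≤ a)
    (h335F : ∀ (y : Y) (v : Off ν n) (κ μ : Fin ν) (hκ : (v κ : ℕ) + 1 < n) (hμ : (v μ : ℕ) + 1 < n)
      (hκ' : ((succOff v μ hμ) κ : ℕ) + 1 < n),
      ‖cpxHom (g y (succOff v μ hμ) * W ((y, succOff v μ hμ), κ) * (g y (succOff (succOff v μ hμ) κ hκ'))ᵀ) -
        cpxHom (g y v * W ((y, v), κ) * (g y (succOff v κ hκ))ᵀ)‖ ≤ f)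
    (B : Y × Cp → ℂ) :
    ((1 - ((ν * (n - 1)).choose 2 : ℕ) * (2 * f + 2 * a ^ 2)) * (((n : ℝ) - 2 * w) / n) ^ ν) ^ 2 /
        (μ0 * (1 * (n : ℝ) ^ ν) + (1 / w + ν * ((n : ℝ) - 1) * (2 * f + 2 * a ^ 2)) *
          (ν * (n : ℝ) ^ ν * (1 / w + ν * ((n : ℝ) - 1) * (2 * f + 2 * a ^ 2)))) * nsq B ≤
      (star B ⬝ᵥ (sandwich (gramForm μ0 (covDiff bsrc (btgt σ) W))
        (covFamily sB (RgenFam W hW (nestedList L m))) *ᵥ B)).re :=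
  coarse_coercive_plateau_blocks_pair_curl W hW (nestedList L m) σ g hg (disp_posWord_nestedList L m) hw h2w hμ0 hf hε
    h335A h335F B

end End

/-! ## §5 The j-uniformity arithmetic (closed forms; `n = L^j`, `C = O(1)Mα₀` of (3.35)) -/

section Arith

/-- `(m choose 2) ≤ m²∕2`. [folklore] -/
theorem choose_two_le (m : ℕ) : ((m.choose 2 : ℕ) : ℝ) ≤ (m : ℝ) ^ 2 / 2 := by
  rw [Nat.choose_two_right]
  have h : ((m * (m - 1) / 2 : ℕ) : ℝ) ≤ (m * (m - 1) : ℕ) / 2 := by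
    have := Nat.div_mul_le_self (m * (m - 1)) 2
    rw [le_div_iff₀ (by norm_num : (0:ℝ) < 2)]
    exact_mod_cast this
  refine h.trans ?_
  rcases Nat.eq_zero_or_pos m with rfl | hm
  · simp
  · rw [Nat.cast_mul, Nat.cast_sub hm, Nat.cast_one]
    nlinarith [(Nat.cast_nonneg m : (0:ℝ) ≤ m)]

/-- **`n²α ≤ 2C(1+C)`**: with `a ≤ C∕n`, `f ≤ C∕n²` (`C ≥ 0`, `n ≥ 1`) the plaquette input `α = 2f + 2a²` obeys
`n²·α ≤ 2C(1 + C)` — j-UNIFORM («n²α = O(Mα₀)», p223754's header). [folklore] -/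
theorem nsq_alpha_le {C a f : ℝ} {n : ℕ} (hn : 1 ≤ n) (hC : 0 ≤ C) (ha0 : 0 ≤ a) (ha : a ≤ C / n) (hf : f ≤ C / n ^ 2) :
    (n : ℝ) ^ 2 * (2 * f + 2 * a ^ 2) ≤ 2 * C * (1 + C) := by
  have hn' : (1 : ℝ) ≤ n := by exact_mod_cast hn
  have hn0 : (0 : ℝ) < n := by linarith
  have h1 : (n : ℝ) ^ 2 * f ≤ C := by
    have := mul_le_mul_of_nonneg_left hf (sq_nonneg (n : ℝ))
    rwa [mul_div_cancel₀ _ (pow_ne_zero 2 hn0.ne')] at this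
  have h2 : (n : ℝ) * a ≤ C := by
    have := mul_le_mul_of_nonneg_left ha hn0.le
    rwa [mul_div_cancel₀ _ hn0.ne'] at this
  have h3 : (n : ℝ) ^ 2 * a ^ 2 ≤ C ^ 2 := by
    rw [← mul_pow]; exact pow_le_pow_left₀ (by positivity) h2 2
  have h4 : C ^ 2 ≤ C * (1 + C) * 1 := by nlinarith
  nlinarith

/-- **THE MIXED-LOOP DEFECT IS j-UNIFORM**: `ε = (ν(n−1) choose 2)·α ≤ ν²·C(1+C)`. [folklore] -/
theorem eps_mixed_le {C a f : ℝ} {ν n : ℕ} (hn : 1 ≤ n) (hC : 0 ≤ C) (ha0 : 0 ≤ a) (ha : a ≤ C / n)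
    (hf0 : 0 ≤ f) (hf : f ≤ C / n ^ 2) :
    ((ν * (n - 1)).choose 2 : ℕ) * (2 * f + 2 * a ^ 2) ≤ (ν : ℝ) ^ 2 * (C * (1 + C)) := by
  have hα0 : 0 ≤ 2 * f + 2 * a ^ 2 := by positivity
  have hc : (((ν * (n - 1)).choose 2 : ℕ) : ℝ) ≤ ((ν : ℝ) * n) ^ 2 / 2 := by
    refine (choose_two_le _).trans ?_
    have : ((ν * (n - 1) : ℕ) : ℝ) ≤ (ν : ℝ) * n := by
      rw [Nat.cast_mul, Nat.cast_sub hn, Nat.cast_one]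
      nlinarith [(Nat.cast_nonneg ν : (0:ℝ) ≤ ν), (show (1:ℝ) ≤ n by exact_mod_cast hn)]
    have h0 : (0 : ℝ) ≤ ((ν * (n - 1) : ℕ) : ℝ) := Nat.cast_nonneg _
    gcongr
  have key := nsq_alpha_le hn hC ha0 ha hf
  calc (((ν * (n - 1)).choose 2 : ℕ) : ℝ) * (2 * f + 2 * a ^ 2)
      ≤ ((ν : ℝ) * n) ^ 2 / 2 * (2 * f + 2 * a ^ 2) := mul_le_mul_of_nonneg_right hc hα0
    _ = (ν : ℝ) ^ 2 * ((n : ℝ) ^ 2 * (2 * f + 2 * a ^ 2)) / 2 := by ring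
    _ ≤ (ν : ℝ) ^ 2 * (2 * C * (1 + C)) / 2 := by gcongr
    _ = (ν : ℝ) ^ 2 * (C * (1 + C)) := by ring

/-- **THE THIN-LOOP BOUND IS j-UNIFORM IN THE STRONG SENSE**: `H·n = ν(n−1)α·n ≤ 2ν·C(1+C)` — so `H·w = O(Mα₀)` for
the plateau width `w ≤ n`, i.e. `(1∕w + H)² = (1∕w)²(1 + O(Mα₀))²` as E-I3's «U = 1 counting × (1 + O(Mα₀))» needs. [folklore] -/
theorem thin_times_n_le {C a f : ℝ} {ν n : ℕ} (hn : 1 ≤ n) (hC : 0 ≤ C) (ha0 : 0 ≤ a) (ha : a ≤ C / n)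
    (hf0 : 0 ≤ f) (hf : f ≤ C / n ^ 2) :
    (ν : ℝ) * ((n : ℝ) - 1) * (2 * f + 2 * a ^ 2) * n ≤ 2 * ν * (C * (1 + C)) := by
  have hα0 : 0 ≤ 2 * f + 2 * a ^ 2 := by positivity
  have hn' : (1 : ℝ) ≤ n := by exact_mod_cast hn
  have key := nsq_alpha_le hn hC ha0 ha hf
  have hν : (0 : ℝ) ≤ ν := Nat.cast_nonneg ν
  calc (ν : ℝ) * ((n : ℝ) - 1) * (2 * f + 2 * a ^ 2) * n
      ≤ (ν : ℝ) * n * (2 * f + 2 * a ^ 2) * n := by gcongr; linarith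
    _ = (ν : ℝ) * ((n : ℝ) ^ 2 * (2 * f + 2 * a ^ 2)) := by ring
    _ ≤ (ν : ℝ) * (2 * C * (1 + C)) := mul_le_mul_of_nonneg_left key hν
    _ = 2 * ν * (C * (1 + C)) := by ring

end Arith

/-! ## §6 Non-vacuity -/

/-- One block of side 3 (`ν = 1`, `w = 1`, fibre `Unit`, flat `W ≡ 1`, trivial gauge `g ≡ 1`, `μ₀ = 1`, `a = f = 0`), the
(3.55)-shape contour `nestedList 2 1`: every hypothesis holds and the END gives the explicit constant `1∕54`. [folklore] -/
example (B : Unit × Unit → ℂ) :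
    (1 / 54 : ℝ) * nsq B ≤
      (star B ⬝ᵥ (sandwich (gramForm 1 (covDiff bsrc (btgt (fun (_ : Fin 1) (_ : Unit) => ()))
          fun _ : Bond Unit 1 3 => (1 : Matrix Unit Unit ℝ)))
        (covFamily (sB (Y := Unit) (ν := 1) (n := 3))
          (RgenFam (fun _ : Bond Unit 1 3 => (1 : Matrix Unit Unit ℝ)) flat_orth (nestedList 2 1))) *ᵥ B)).re := by
  have h := coarse_coercive_plateau_blocks_nested_curl (Y := Unit) (Cp := Unit) (ν := 1) (n := 3) (w := 1) (μ0 := 1)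
    (a := 0) (f := 0) (fun _ : Bond Unit 1 3 => (1 : Matrix Unit Unit ℝ)) flat_orth (fun (_ : Fin 1) (_ : Unit) => ()) 2 1
    (fun _ _ => (1 : Matrix Unit Unit ℝ)) (fun _ _ => by simp) Nat.one_pos (by norm_num) one_pos le_rfl (by norm_num)
    (fun y v κ h => by simp) (fun y v κ μ hκ hμ hκ' => by simp) B
  convert h using 2
  norm_num

end

end Summit.QuantumFields.BalabanUV.Beta.CovariantPlateauBlocksPairCurl
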